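import Summits.BirchSwinnertonDyer.BirchSwinnertonDyer.Theorems.AdditiveBranchIMCGordTwoRankOneHeegnerKolyvaginSelfTwistUnitsFrame
import Summits.BirchSwinnertonDyer.BirchSwinnertonDyer.Theorems.AdditiveBranchIMCGordTwoRankOneHeegnerKolyvaginIndexLink
import HarnessLib

/-!
# Route `AdditiveBranchIMC` (rung K1), crux `GordTwoRankOne` (item 19358): the HEIGHT-FREE
# Heegner–Kolyvagin road — Part 22d: the self-twist frame's input decided per pair by ONE McCallum
# certificate for the GOOD ordinary `p*`-twist `V` over `K = ℚ(√−p)`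
# (cell `bsd-addord`, second prover lane `bsd-addord-k1-c3x`, gen 5; `--supports 19358 --as helper` only)

HONEST FRAMING. THEOREMS ONLY: no definition, no new named fact, no `sorry`; nothing is booked; no
certificate is computed here; BSD is not proved by any of this; the crux stays OPEN at class level.
Parts 21/22 (p573821 … p577019) reduced the LOWER half of `BSD(E,p)` on the self-twist rows of cell
(G-ord, `e = 2`) (`p ≡ 3 (mod 4)`, `K = ℚ(√−p)`, `V` = the GOOD ordinary `p*`-twist, `E ≅ V^{(d_K)}`) to the
Jetchev–Skinner–Wan inequality `2·v_p[V(K):ℤP] ≤ v_p #Ш(V/K) + v_p ∏c(V) + v_p ∏c(E) (+ 2·v_p #𝓞_K^×)`. THIS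
FILE records that, exactly as on lane B's first frame (Part 2 §3 / Part 13), the input is decided PER PAIR by
ONE certificate in McCallum's any-level structure theorem (tree fact
`McCallum1991_card_sha_primary_baseChange_of_derivedPoint_not_divisible_anyLevel`, AS PRINTED: `K` imaginary
quadratic with `d_K ∉ {−3, −4}` and the Heegner hypothesis, `p` odd, `ρ_{E,p^∞}` onto — NO `p ∤ d_K`; McCallum
1991 §3 p. 299, §5): if `p^{M₀} ∥ y_K` in `V(K[1])` and some derived Heegner point `P_n` of `V` at a square-free
Kolyvagin level `n` is not divisible by `p` in `V(K_n)`, then `#Ш(V/K)[p^∞] = p^{2M₀}` and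
`v_p[V(K):ℤy_K] ≤ M₀` (half of McCallum's Lemma 5.1, Part 13 §12), so `2·v_p[V(K):ℤP] ≤ v_p #Ш(V/K)` SHARP —
a fortiori the frame's inequality with any non-negative slack.

* §8 `two_mul_padicValNat_index_le_shaOrder_of_anyLevelCertificate_of_map` — the sharp consequence for
  any curve (the common core of Part 2's `indexLowerBoundAt_of_anyLevelCertificate` and this frame);
  `missingLowerBoundAt_of_selfTwistFrame_of_anyLevelCertificate` — LOWER(E,p) on the frame from PUBLISHED
  facts + ONE certificate for `(V, ℚ(√−p))` (here `p ≥ 7`: `d_K = −p ∉ {−3,−4}`), the certificate being a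
  finite statement about Heegner points of a curve with GOOD ORDINARY reduction at `p`.

References: [McCallumLMS1991] §1 Theorem (Kolyvagin) (p. 296), §3 (p. 299), §5 Lemma 5.1, Cor. 5.6;
[GrossLMS1991] §4 (4.1); [JetchevSkinnerWan2017] §7.4.1; [Wuthrich2014] Prop. 21; [Miller2011LMS] Def. 1.1.
-/

set_option autoImplicit false
set_option linter.dupNamespace false
noncomputable section

open scoped Classical NumberField
open WeierstrassCurve NumberField IsDedekindDomain
  Literature.NumberTheory.EllipticCurves Literature.NumberTheory.EllipticCurves.ModularForms
  Literature.NumberTheory.EllipticCurves.Rank1Residual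
  Literature.NumberTheory.EllipticCurves.Rank1Residual.Typed
  Summit.BirchSwinnertonDyer.Rank1Residual
  Summit.BirchSwinnertonDyer.Rank1Residual.Additive

namespace Summit.BirchSwinnertonDyer.BirchSwinnertonDyer.Theorems.AdditiveBranchIMCGordTwoRankOne.HeegnerKolyvagin

/-! ### §8 One McCallum certificate for `(V, ℚ(√−p))` decides the frame's input -/

/-- **The SHARP consequence of one McCallum certificate: `2·v_p[E(K):ℤP] ≤ v_p #Ш(E/K)`** (McCallum 1991
§1 Theorem / Cor. 5.6: `#Ш(E/K)[p^∞] = p^{2M₀}`; Lemma 5.1: `v_p[E(K):ℤP] ≤ M₀` when `p^{M₀+1} ∤ P_1 = j P`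
in `E(K[1])` and `E(K)[p] = 0`). Any globally minimal non-CM `E/ℚ`, `K` imaginary quadratic with
`d_K ∉ {−3,−4}` and the Heegner hypothesis for `N_E`, `p` odd with `ρ_{E,p^∞}` onto; NO hypothesis relating
`p` and `d_K`. The common core of Part 2's `indexLowerBoundAt_of_anyLevelCertificate` (which adds the slack
`2·v_p ∏c(E)`). [cite: McCallumLMS1991, §1 Theorem (Kolyvagin) (p. 296); §5 Lemma 5.1, Cor. 5.6]
[cite: GrossLMS1991, §2 and §4 (4.1)] -/
theorem two_mul_padicValNat_index_le_shaOrder_of_anyLevelCertificate_of_map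
    (hKoAny : McCallum1991_card_sha_primary_baseChange_of_derivedPoint_not_divisible_anyLevel)
    (W : WeierstrassCurve ℚ) [W.IsElliptic] [W.IsGloballyMinimal] [NeZero (W.conductorNorm ℤ)]
    (p : ℕ) [Fact p.Prime] (K : Type) [Field K] [NumberField K]
    (hCM : ¬ W.HasCM) (hK : IsImaginaryQuadratic K) (hD3 : NumberField.discr K ≠ -3)
    (hD4 : NumberField.discr K ≠ -4) (hH : SatisfiesHeegnerHypothesis (W.conductorNorm ℤ) K)
    (hp2 : p ≠ 2) (htower : ∀ k : ℕ, W.HasSurjectiveModNGaloisRep (p ^ k : ℕ))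
    (Dt : ModularParametrizationData W (W.conductorNorm ℤ)) (β : ℤ) (ι : K →+* ℂ)
    (d₁ : KolyvaginHeegnerData Dt β ι 1) (hy : ¬ IsOfFinAddOrder d₁.derivedPoint) (M₀ : ℕ)
    (hdiv : ∃ Q : (W.baseChange (ringClassField K ι 1)).toAffine.Point,
      ((p ^ M₀ : ℕ) : ℤ) • Q = d₁.derivedPoint)
    (hndiv : ¬ ∃ Q : (W.baseChange (ringClassField K ι 1)).toAffine.Point,
      ((p ^ (M₀ + 1) : ℕ) : ℤ) • Q = d₁.derivedPoint)
    (n : ℕ) (d : KolyvaginHeegnerData Dt β ι n) (hn : Squarefree n)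
    (hKoly : ∀ ℓ ∈ n.primeFactors, Zhang2014.IsKolyvaginPrime (W.conductorNorm ℤ) W K p ℓ)
    (hP : ¬ ∃ Q : (W.baseChange (ringClassField K ι n)).toAffine.Point, (p : ℤ) • Q = d.derivedPoint)
    (P : (W.baseChange K).toAffine.Point)
    (j : (W.baseChange K).toAffine.Point →+ (W.baseChange (ringClassField K ι 1)).toAffine.Point)
    (hj : j P = d₁.derivedPoint)
    (hfin : Finite (W.baseChange K).sha) :
    2 * padicValNat p (AddSubgroup.zmultiples P).index ≤ padicValNat p (W.baseChange K).shaOrder := by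
  -- adapted from Part 13 `indexLowerBoundAt_of_anyLevelCertificate_of_map` (sharp form, no Tamagawa slack)
  have hp : p.Prime := Fact.out
  haveI : (W.baseChange K).IsElliptic := by rw [baseChange]; infer_instance
  have hsurj1 : W.HasSurjectiveModNGaloisRep p := by simpa using htower 1
  have hbot := torsionBy_eq_bot_of_isImaginaryQuadratic W K hK hp hp2 hsurj1
  have hA : ∀ a : (W.baseChange K).toAffine.Point, (p : ℤ) • a = 0 → a = 0 := by
    intro a ha
    have hmem : a ∈ AddSubgroup.torsionBy (W.baseChange K).toAffine.Point (p : ℤ) :=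
      (Submodule.mem_torsionBy_iff (p : ℤ) a).mpr ha
    rw [hbot] at hmem
    exact (AddSubgroup.mem_bot).mp hmem
  have hPinf : ¬ IsOfFinAddOrder P := fun h ↦ hy (by rw [← hj]; exact j.isOfFinAddOrder h)
  have hIM : padicValNat p (AddSubgroup.zmultiples P).index ≤ M₀ :=
    padicValNat_index_le_of_not_zsmul_map j hp hA hPinf (by rw [hj]; exact hndiv)
  have hcard := hKoAny W hCM K hK hD3 hD4 hH p hp2 htower Dt β ι d₁ hy M₀ hdiv hndiv n d hn hKoly hP
  haveI := hfin
  have hsha : padicValNat p (W.baseChange K).shaOrder = 2 * M₀ := by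
    rw [WeierstrassCurve.shaOrder, ← padicValNat_card_addPrimaryComponent (A := (W.baseChange K).sha) p,
      hcard, padicValNat.prime_pow]
  omega

/-- **THE FRAME'S INPUT DECIDED BY ONE CERTIFICATE: LOWER(E,p) on the self-twist frame from PUBLISHED facts +
ONE McCallum certificate for the GOOD ordinary twist `V` over `ℚ(√−p)`.** Data: the frame of
`missingLowerBoundAt_of_selfTwistFrame_units` (`V` good at the odd `p` with `L(V,1) ≠ 0`, `K` imaginary
quadratic with `d_K = −p ∉ {−3,−4}` — so `p ≥ 7` — and the Heegner hypothesis for `N_V`, `E = Cd • V^{(d_K)}`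
globally minimal of analytic rank `1` with `ρ_{E,p^∞}` onto, the Manin-good datum `Dt` of `V`, its Heegner
point `P ∈ V(K)` and the inclusion `j : V(K) → V(K[1])` with `j P = P_1`), plus the CERTIFICATE: `p^{M₀} ∥ P_1`
and a derived point `P_n ∉ pV(K_n)` at a square-free Kolyvagin level `n`. PUBLISHED binders `hGZ`, `hKo`,
`hKoAny` (McCallum), `hW21` (Wuthrich), `hGZK`, `hmod`. CONCLUSION `Typed.MissingLowerBoundAt W p`. The
certificate concerns Heegner points of a curve with GOOD ORDINARY reduction at `p` — the instrument question
(derived points modulo `p`, Jetchev–Lauter–Stein 2009) with no additive prime in it.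
[cite: McCallumLMS1991, §1 Theorem (Kolyvagin) (p. 296); §5 Lemma 5.1, Cor. 5.6]
[cite: JetchevSkinnerWan2017, §7.4.1 (eq:shalower)] [cite: Wuthrich2014, Prop. 21 (p. 400)] -/
theorem missingLowerBoundAt_of_selfTwistFrame_of_anyLevelCertificate
    (hGZK : rank_eq_analyticRank_of_analyticRank_le_one) (hmod : hasEntireLFunction_rat)
    (hW21 : Wuthrich2014.sha_dvd_analyticSha)
    (hKoAny : McCallum1991_card_sha_primary_baseChange_of_derivedPoint_not_divisible_anyLevel)
    (W : WeierstrassCurve ℚ) [W.IsElliptic] [W.IsGloballyMinimal] (p : ℕ) [Fact p.Prime] (hp2 : p ≠ 2)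
    (hr : W.analyticRank = 1) (htower : ∀ k : ℕ, W.HasSurjectiveModNGaloisRep (p ^ k : ℕ))
    (V : WeierstrassCurve ℚ) [V.IsElliptic] [V.IsGloballyMinimal] [NeZero (V.conductorNorm ℤ)] (hCM : ¬ V.HasCM)
    (K : Type) [Field K] [NumberField K] (hK : IsImaginaryQuadratic K)
    (hdisc : NumberField.discr K = -(p : ℤ)) (hD3 : NumberField.discr K ≠ -3)
    (Cd : VariableChange ℚ) (hCd : Cd • V.quadraticTwist (NumberField.discr K : ℚ) = W)
    (hVgood : V.HasGoodReductionAtPrime p) (hLV : V.entireLFunction 1 ≠ 0)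
    (hHN : SatisfiesHeegnerHypothesis (V.conductorNorm ℤ) K)
    (hGZ : gross_zagier (V.conductorNorm ℤ) V K) (hKo : kolyvagin (V.conductorNorm ℤ) V K)
    (Dt : ModularParametrizationData V (V.conductorNorm ℤ)) (H : HeegnerDatum (V.conductorNorm ℤ) (NumberField.discr K))
    (ι : K →+* ℂ) (P : (V.baseChange K).toAffine.Point)
    (hPt : WeierstrassCurve.Affine.Point.map ι.toRatAlgHom P = heegnerPointComplex Dt H) (hc : ¬ (p : ℤ) ∣ Dt.c)
    -- the certificate for `(V, K)`
    (d₁ : KolyvaginHeegnerData Dt H.β ι 1) (hy : ¬ IsOfFinAddOrder d₁.derivedPoint) (M₀ : ℕ)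
    (hdiv : ∃ Q : (V.baseChange (ringClassField K ι 1)).toAffine.Point,
      ((p ^ M₀ : ℕ) : ℤ) • Q = d₁.derivedPoint)
    (hndiv : ¬ ∃ Q : (V.baseChange (ringClassField K ι 1)).toAffine.Point,
      ((p ^ (M₀ + 1) : ℕ) : ℤ) • Q = d₁.derivedPoint)
    (n : ℕ) (d : KolyvaginHeegnerData Dt H.β ι n) (hn : Squarefree n)
    (hKoly : ∀ ℓ ∈ n.primeFactors, Zhang2014.IsKolyvaginPrime (V.conductorNorm ℤ) V K p ℓ)
    (hP : ¬ ∃ Q : (V.baseChange (ringClassField K ι n)).toAffine.Point, (p : ℤ) • Q = d.derivedPoint)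
    (j : (V.baseChange K).toAffine.Point →+ (V.baseChange (ringClassField K ι 1)).toAffine.Point)
    (hj : j P = d₁.derivedPoint) :
    Typed.MissingLowerBoundAt W p := by
  have hD0 : (NumberField.discr K : ℚ) ≠ 0 := by exact_mod_cast NumberField.discr_ne_zero K
  have hD4 : NumberField.discr K ≠ -4 := by
    rw [hdisc]
    intro h
    have h4 : (p : ℤ) = 4 := by omega
    have hp4 : p = 4 := by exact_mod_cast h4
    exact (by decide : ¬ Nat.Prime 4) (hp4 ▸ (Fact.out : p.Prime))
  have htowerV : ∀ k : ℕ, V.HasSurjectiveModNGaloisRep (p ^ k : ℕ) := fun k ↦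
    (GaloisImage.hasSurjectiveModNGaloisRep_pow_iff_of_model_twist V p hD0 ⟨Cd, hCd⟩ k).mp (htower k)
  have hsurj : W.HasSurjectiveModNGaloisRep p := by simpa using htower 1
  refine missingLowerBoundAt_of_selfTwistFrame_units hGZK hmod hW21 W p hp2 hr hsurj V (V.conductorNorm ℤ) K hK
    hdisc Cd hCd hVgood hLV hHN hGZ hKo Dt H ι P hPt hc fun hfin ↦ ?_
  have hsharp := two_mul_padicValNat_index_le_shaOrder_of_anyLevelCertificate_of_map hKoAny V p K hCM hK hD3 hD4
    hHN hp2 htowerV Dt H.β ι d₁ hy M₀ hdiv hndiv n d hn hKoly hP P j hj hfin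
  have e : (2 * padicValNat p (AddSubgroup.zmultiples P).index : ℤ) ≤ padicValNat p (V.baseChange K).shaOrder := by
    exact_mod_cast hsharp
  have h0 : (0 : ℤ) ≤ padicValNat p V.tamagawaProduct + padicValNat p W.tamagawaProduct +
      2 * padicValNat p (Units.torsionOrder K) := by positivity
  linarith

end Summit.BirchSwinnertonDyer.BirchSwinnertonDyer.Theorems.AdditiveBranchIMCGordTwoRankOne.HeegnerKolyvagin

end
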